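import Literature.MathematicalPhysics.QuantumFieldTheory.Balaban1983to89.Node00.OpsYOps312OfRecordPar
import Literature.MathematicalPhysics.QuantumFieldTheory.Balaban1983to89.B9BackgroundsKLevelV1R
import Literature.MathematicalPhysics.QuantumFieldTheory.Balaban1983to89.B9Eq3115KnitLetterYRowCloseness
import Literature.MathematicalPhysics.QuantumFieldTheory.Balaban1983to89.B9QLettersAtPins
import Literature.MathematicalPhysics.QuantumFieldTheory.Balaban1983to89.B9Thm312WholeLeaf

/-!
# BalabanUVNodes ∕ N06 ([B9], `Dag.B9_main`) — CASCADE-K PIECE K2 (director-ym №383): THE DISPLAYED LAWS OF THE ROWS-20∕21 ASSEMBLER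
# `…N06Thm312313AtPinsStateSUCLEPar.t312_t313_of_pins_stateSUCLE_par` — PART 2: the law `hqK` (the letters `Q(U) : 𝔠⁽ᵖ⁾ → 𝔠_Z⁽ᵖ⁾`) FROM A ROW KERNEL, and the
# KNIT LETTER's ROW KERNEL on the member's local class (3.35)

Track A of `YM-PLAN.md` (cell `pub-ymgap`, HUMAN RULING D-0062), node **N06** = [Balaban1985BackgroundPropagators] Thms 3.1–3.15; bundle F7 rows 20–21, seat
`pub-ymgap-dag-n06-l` (g37); part 1 = `…N06Thm312313ParLawsQ` (the law `hC1T`).  WHY.  The assembler `t312_t313_of_pins_stateSUCLE_par` (this seat, CASCADE-K K2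
item 4) displays `hqK : … Reg335 c α₀ U → ∀ p ≤ 2, HasMaj (cNorm 1 H blk p) (cNorm 1 H blkZ p) ((𝔬12 x).Q U) (BQp·e^{−δ12₃d})` — the letters `q2 ∕ q1` of the averaging
operator, which face v1.7 derived from the straight-pair pin `Q = QcoKH … parBY` through dag-n06-w5's `B9QLettersAtPins` (flat weights `q_y(f)` of total mass one,
support radius `ℓ + 4`, contracting straight-contour transports).  At the KNIT letter of record (`qKnitOfRecord = QknitY`, print's (3.115) `Q(U)`) the pin is
`Q = QcoKHq … (qKnitOfRecord …)` (node00-def-Y's `𝔮`-generic model, `Node00.OpsYOps312OfRecordPar` §0) and the kinematics is a ROW KERNEL: this seat's corner row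
form `B9Eq3115KnitLetterYRowCloseness.norm_QknitY_sub_boxAvg_le` (the knit letter is the corner-tree transported flat average up to `K_col·α₀′·Σ_f boxK ι f‖a f‖` on the
local class (3.35)) gives `‖(Q(U)a)(ι)‖ ≤ Σ_f (q_ι(f) + K_col α₀′ boxK ι f)·‖a f‖`, a kernel `≥ 0` of row mass `≤ 1 + 2(d+1)K_col α₀′` (`sum_boxK_le`) supported within
`ℓ + 4` of the block map (`boxK ι f ≠ 0 ⇒ f₋` in an end block of `ι`, `iterBlockOf_of_boxK_ne_zero`, then [6]'s `geomT_dist_ends_le` as in n06-w3's `dist_le_of_qwt_ne_zero_bI`).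
§1 THE LAW FROM ANY ROW KERNEL (generic letter `𝔮`; w5's `QcoKH_apply ∕ abs_QcoKH_apply_le ∕ hasMajorantHom_QcoKH ∕ hasMaj_QcoKH` re-pressed with `q_y(f)` replaced by a
kernel `k ≥ 0` with `‖(𝔮(U)a)(ι)‖ ≤ Σ_f k ι f‖a f‖`, `k ι f ≠ 0 ⇒ d(ι, bI f) ≤ ℓ+4`, `Σ_f k ι f ≤ K`): ★ `QcoKHq_apply`, ★ `abs_QcoKHq_apply_le_of_row`, ★★
`hasMajorantHom_QcoKHq_of_rowKernel` (majorant `K·e^{δ(ℓ+4)}·e^{−δd}`), ★★ `hasMaj_QcoKHq_of_rowKernel` (`𝔠⁽ᵖ⁾ → 𝔠_Z⁽ᵖ⁾`, `K·Lᵖ·e^{2ε(ℓ+4)}·e^{−εd}` above the (2.60) threshold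
`p·log L ≤ ε(2L²−1)M`).  §2 THE KNIT ROW KERNEL ON (3.35): ★ `dist_le_of_boxK_ne_zero_bI ∕ dist_le_of_knitRow_ne_zero_bI ∕ sum_knitRow_le`, ★★ `norm_QknitY_apply_le_sum_knitRow`
(`G ≤ U(N)`, `c₀ ≤ 10`, `0 ≤ Mα₀`, x-free numerics `0 < α₀′ ≤ α_Q`, `K_pl(Mα₀)·L⁴ < α₀′`), ★★★ `hasMaj_QcoKHq_QknitY_of_reg335P` (the class letters of `Q(U)` at the knit
letter, majorant `(1 + 2(d+1)K_col α₀′)·Lᵖ·e^{2ε(ℓ+4)}·e^{−εd}`).  §3 ★★★ `hqK_knit_of_laws` — the assembler's binder `hqK` VERBATIM at any `𝔬12` pinned by `hQco12` to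
`QcoKHq … (qKnitOfRecord …)` and `hblk12 ∕ hblkZ12`, from the displayed regime bridge `hRP` (the certificate's `hRP1`: the carrier's class at `c` refines the member's local
class `(bg9KP … SU(N) …).Reg335 c₀`, `c₀ ≤ 10`), the x-free numerics `hα' hαQ` and `hKpl : 0 ≤ a ≤ a12 ⇒ K_pl(a)·L⁴ < α₀′` (dag-n06-d's `hKplK` shape), and v1.7's (2.60)
numeric `hM12q : 2·log L ≤ δ12₃(2L²−1)·M12` (`0 < M12`, `0 < δ12₃`); `BQp := (1 + 2(d+1)K_col α₀′)·L²·e^{2δ12₃(ℓ+4)}`.  Today's straight pair stays w5's `hasMaj_Q_of_pins`.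
HONEST FRAMING.  Finite-dimensional lattice bookkeeping for one kinematic letter over this seat's kernel-checked row form; the regime bridge and numerics are
HYPOTHESES; COUNT-NEUTRAL; nothing of [B9]'s propagator estimates asserted; N06 NOT discharged; one finite 𝕋⁴ programme at fixed `ε` — NOT continuum, NOT OS, NOT the
mass gap ∕ Clay.  0 `def`, 0 `sorry`.
-/

noncomputable section

namespace Summit.QuantumFields.YangMills.BalabanUVNodes.N06Thm312313ParLawsQRow

open scoped Matrix.Norms.L2Operator
open Literature.MathematicalPhysics.QuantumFieldTheory.Balaban1983to89
open Literature.MathematicalPhysics.QuantumFieldTheory.Balaban1983to89.Node00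
open Literature.MathematicalPhysics.QuantumFieldTheory.Balaban1983to89.B6KLevelCensusIndexV1 (KIdx kGeo)
open Literature.MathematicalPhysics.QuantumFieldTheory.Balaban1983to89.B9PinMembersKLevelV1 (MemberY geo9Y bg9Y)
open Literature.MathematicalPhysics.QuantumFieldTheory.Balaban1983to89.B9BackgroundsKLevelV1R (RegFamY bg9YR MemOfFam mem_of_reg335R)
open Literature.MathematicalPhysics.QuantumFieldTheory.Balaban1983to89.B7Prop2SpecialUnitary (specialUnitaryUnits specialUnitaryUnits_le_unitaryUnits)
open Literature.MathematicalPhysics.QuantumFieldTheory.Balaban1983to89.B9CoReadingCoordsTranspose (TrIdx trBasis)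
open Literature.MathematicalPhysics.QuantumFieldTheory.Balaban1983to89.B9CoReadingCoords (XBK assembleK blkBK)
open Literature.MathematicalPhysics.QuantumFieldTheory.Balaban1983to89.B9CoReadingCoordsH (XHK blkHK coordOpKH_apply)
open Literature.MathematicalPhysics.QuantumFieldTheory.Balaban1983to89.B9Thm312Whole (Ops cNorm GeoOK wt)
open Literature.MathematicalPhysics.QuantumFieldTheory.Balaban1983to89.B9Thm39ReadingCoords (cR39 cR39_nonneg coordBound39 basisBound39 abs_repr_le norm_sum_smul_basis_le)
open Literature.MathematicalPhysics.QuantumFieldTheory.Balaban1983to89.Node00.OpsYQLetter (QLetterY qKnitOfRecord)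
open Literature.MathematicalPhysics.QuantumFieldTheory.Balaban1983to89.Node00.OpsYOps312OfRecordPar (QcoKHq)
open Literature.MathematicalPhysics.QuantumFieldTheory.Balaban1983to89.B6Geom246MultiLevelTorus (geomT)
open Literature.MathematicalPhysics.QuantumFieldTheory.Balaban1983to89.B6GlobalChartV1 (blkV1)
open Literature.MathematicalPhysics.QuantumFieldTheory.Balaban1983to89.B6RandomWalkHom (HasMajorantHom)
open Literature.MathematicalPhysics.QuantumFieldTheory.Balaban1983to89.B6Ineq2142KLevelV1 (lvl β qwt qwt_nonneg geomT_dist_ends_le)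
open Literature.MathematicalPhysics.QuantumFieldTheory.Balaban1983to89.B9Eq3132Ineq2142Covariant (qK_apply sum_qwt_eq_one two_le_RMh)
open Literature.MathematicalPhysics.QuantumFieldTheory.Balaban1983to89.B9GeoNormsKLevelV1 (geo9K geo9K_dist_nonneg)
open Literature.MathematicalPhysics.QuantumFieldTheory.Balaban1983to89.B9GeoLemma21KLevelV1 (geo9K_dist_comm geo9K_len_pos geo9K_one_le_L geo9Y_dist_triangle geo9Y_dist_comm geo9Y_len_pos one_le_Mh one_le_P one_le_k)
open Literature.MathematicalPhysics.QuantumFieldTheory.Balaban1983to89.B9Thm34Ext (toB6)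
open Literature.MathematicalPhysics.QuantumFieldTheory.Balaban1983to89.B11SectG (HasMaj BlockNorm)
open Literature.MathematicalPhysics.QuantumFieldTheory.Balaban1983to89.B9Letters313AtOneQ (dist_le_of_qwt_ne_zero_bI len_pow_le_of_transfer)
open Literature.MathematicalPhysics.QuantumFieldTheory.Balaban1983to89.B9QstarLettersAtPins (reading_const_collapse)
open Literature.MathematicalPhysics.QuantumFieldTheory.Balaban1983to89.B9Ineq349SiteComposite (distB)
open Literature.MathematicalPhysics.QuantumFieldTheory.Balaban1983to89.B9Ineq349SiteFromBlocks (distB_triangle)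
open Literature.MathematicalPhysics.QuantumFieldTheory.Balaban1983to89.B6Ineq288MultiLevelTorus (dist_symm_geoBT)
open Literature.MathematicalPhysics.QuantumFieldTheory.Balaban1983to89.B7Eq78Linearization (conjR)
open Literature.MathematicalPhysics.QuantumFieldTheory.Balaban1983to89.B9B8KnitColumnGauge (norm_conjR_le_of_unitary)
open Literature.MathematicalPhysics.QuantumFieldTheory.Balaban1983to89.B9Eq316AveragingTransposeZd (alphaQ)
open Literature.MathematicalPhysics.QuantumFieldTheory.Balaban1983to89.B9Eq3115KnitLetterY (QknitY)
open Literature.MathematicalPhysics.QuantumFieldTheory.Balaban1983to89.B9Eq3115KnitLetterYOnto (kCol kCol_nonneg)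
open Literature.MathematicalPhysics.QuantumFieldTheory.Balaban1983to89.B9Eq3115KnitLetterYRowCloseness (boxK boxK_nonneg sum_boxK_le iterBlockOf_of_boxK_ne_zero boxT boxT_mem norm_QknitY_sub_boxAvg_le)
open Literature.MathematicalPhysics.QuantumFieldTheory.Balaban1983to89.B9C2FormBoxRegimeY (Kpl)
open Literature.MathematicalPhysics.QuantumFieldTheory.Balaban1983to89.B9BackgroundsKLevelV1P (bg9KP mem_of_reg335P)
open Literature.MathematicalPhysics.QuantumFieldTheory.Balaban1983to89.B7Prop2Explicit (unitaryUnits unitaryUnits_le_U1)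

variable {N : ℕ}

/-! ## §1 The law `hqK` from a ROW KERNEL, for a generic letter `𝔮` read in def-Y's `𝔮`-generic coordinate model `QcoKHq` -/

section RowKernel

variable {𝔸 : Type} [NormedRing 𝔸] [NormedAlgebra ℂ 𝔸] [CompleteSpace 𝔸] [FiniteDimensional ℝ 𝔸]
variable {κ : Type} [Fintype κ]
variable {d ℓ : ℕ} {hd : 1 ≤ d + 1} {hL : Odd (ℓ + 1) ∧ 1 < ℓ + 1} {b₀ b₁ : ℝ}
variable (i : KIdx d ℓ hd hL b₀ b₁) (b : Module.Basis κ ℝ 𝔸) (B : B9.Backgrounds) (cfg : B.Cfg → CfgY 𝔸 i) (𝔮 : QLetterY 𝔸 i)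
variable {bI : FBondY i → IBondY i}

/-- ★ **THE `𝔮`-GENERIC MODEL, UNFOLDED**: `(QcoKHq … 𝔮 U₁ F)(y, ν, c, c′) = (cR39 b)⁻¹ · repr_c ((𝔮(U₁) w)(y))` with `w_f = Σ_a F(f, ν, a, c′)·b_a` the re-assembled slice.
[cite: Balaban1985BackgroundPropagators, (3.13) p.393, (3.115) p.418, p.389 (dictionary)] -/
theorem QcoKHq_apply (U₁ : B.Cfg) (F : XBK κ i → ℝ) (q : XHK κ i) :
    QcoKHq i b B cfg 𝔮 U₁ F q = (cR39 b)⁻¹ * b.repr (𝔮 (cfg U₁) (assembleK b q.2.1 q.2.2.2 F) q.1) q.2.2.1 := by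
  simp only [QcoKHq, LinearMap.smul_apply, Pi.smul_apply, smul_eq_mul, coordOpKH_apply, LinearMap.restrictScalars_apply]

/-- ★ **THE POINTWISE BOUND FROM A ROW KERNEL**: if `‖(𝔮(U₁)a)(ι)‖ ≤ Σ_f k ι f·‖a f‖` with `k ≥ 0`, then
`|(QcoKHq … F)(y, ν, c, c′)| ≤ (cR39 b)⁻¹ · coordBound · basisBound · Σ_f k y f · Σ_a |F(f, ν, a, c′)|`. [cite: Balaban1985BackgroundPropagators, (3.13)–(3.15) p.393, p.389 (dictionary)] -/
theorem abs_QcoKHq_apply_le_of_row (U₁ : B.Cfg) (k : IBondY i → FBondY i → ℝ) (hk : ∀ ι f, 0 ≤ k ι f)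
    (hrow : ∀ (a : FBondY i → 𝔸) (ι : IBondY i), ‖𝔮 (cfg U₁) a ι‖ ≤ ∑ f, k ι f * ‖a f‖) (F : XBK κ i → ℝ) (q : XHK κ i) :
    |QcoKHq i b B cfg 𝔮 U₁ F q| ≤
      (cR39 b)⁻¹ * (coordBound39 b * (basisBound39 b * ∑ f : FBondY i, k q.1 f * ∑ a, |F (f, q.2.1, a, q.2.2.2)|)) := by
  rw [QcoKHq_apply i b B cfg 𝔮 U₁ F q]
  have hc0 : 0 ≤ (cR39 b)⁻¹ := inv_nonneg.mpr (cR39_nonneg b)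
  have hcb : 0 ≤ coordBound39 b := norm_nonneg _
  set S : 𝔸 := 𝔮 (cfg U₁) (assembleK b q.2.1 q.2.2.2 F) q.1 with hS
  have hSn : ‖S‖ ≤ ∑ f : FBondY i, k q.1 f * (basisBound39 b * ∑ a, |F (f, q.2.1, a, q.2.2.2)|) :=
    (hrow _ _).trans (Finset.sum_le_sum fun f _ => mul_le_mul_of_nonneg_left (norm_sum_smul_basis_le b _) (hk _ _))
  have hrepr : |b.repr S q.2.2.1| ≤ coordBound39 b * ‖S‖ := abs_repr_le b S q.2.2.1
  rw [abs_mul, abs_of_nonneg hc0]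
  refine mul_le_mul_of_nonneg_left (hrepr.trans (mul_le_mul_of_nonneg_left (hSn.trans (le_of_eq ?_)) hcb)) hc0
  rw [Finset.mul_sum]
  exact Finset.sum_congr rfl fun f _ => by ring

/-- ★★ **`Q(U₁)` IN COORDINATES IS A LOCAL, BOUNDED TWO-SPACE OPERATOR FOR ANY ROW KERNEL** (w5's `hasMajorantHom_QcoKH` with the flat weights replaced by `k`): from the fine
bonds `XBK` (block map `blkBK bI`) to the coarse bonds `XHK` (`blkHK`), majorant `K·e^{δ(ℓ+4)}·e^{−δd(y,y′)}` for every `δ ≥ 0` — `k ≥ 0` of row mass `≤ K`, vanishing unless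
`d(y, bI f) ≤ ℓ + 4`, reading constant collapsing. [cite: Balaban1985BackgroundPropagators, (3.13)–(3.15) p.393, (3.110) p.417, Thm 3.13 p.426 (the letter Q); Balaban1984PropagatorsII, (2.51) p.232] -/
theorem hasMajorantHom_QcoKHq_of_rowKernel {U₁ : B.Cfg} (k : IBondY i → FBondY i → ℝ) (hk : ∀ ι f, 0 ≤ k ι f)
    (hsupp : ∀ ι f, k ι f ≠ 0 → (geo9K i).dist ι (bI f) ≤ (ℓ : ℝ) + 4) {K : ℝ} (hK : 0 ≤ K) (hmass : ∀ ι, ∑ f, k ι f ≤ K)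
    (hrow : ∀ (a : FBondY i → 𝔸) (ι : IBondY i), ‖𝔮 (cfg U₁) a ι‖ ≤ ∑ f, k ι f * ‖a f‖)
    {δ : ℝ} (hδ : 0 ≤ δ) (R₀ : ℝ) (H₀ : Prop) [Fintype (geo9K i).Site] :
    HasMajorantHom (g := toB6 (geo9K i) R₀ H₀) (blkBK i bI) (blkHK i) (QcoKHq i b B cfg 𝔮 U₁)
      (fun a a' => K * Real.exp (δ * ((ℓ : ℝ) + 4)) * Real.exp (-(δ * (geo9K i).dist a a'))) := by
  intro y' F Bμ hμ q
  change IBondY i at y'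
  have hslice : ∀ f : FBondY i, ∑ a, |F (f, q.2.1, a, q.2.2.2)| ≤ (Fintype.card κ : ℝ) * Bμ := fun f => by
    calc ∑ a, |F (f, q.2.1, a, q.2.2.2)| ≤ ∑ _a : κ, Bμ := Finset.sum_le_sum fun a _ => by
          by_cases hf : bI f = y'
          · exact hμ.bound (f, q.2.1, a, q.2.2.2) hf
          · rw [hμ.off (f, q.2.1, a, q.2.2.2) hf, abs_zero]; exact hμ.nonneg
      _ = (Fintype.card κ : ℝ) * Bμ := by rw [Finset.sum_const, nsmul_eq_mul, Finset.card_univ]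
  have hslice0 : ∀ f : FBondY i, bI f ≠ y' → ∑ a, |F (f, q.2.1, a, q.2.2.2)| = 0 := fun f hf =>
    Finset.sum_eq_zero fun a _ => by rw [hμ.off (f, q.2.1, a, q.2.2.2) hf, abs_zero]
  have hK0 : 0 ≤ K * Real.exp (δ * ((ℓ : ℝ) + 4)) * Real.exp (-(δ * (geo9K i).dist (blkHK i q) y')) := by positivity
  have hpt := abs_QcoKHq_apply_le_of_row i b B cfg 𝔮 U₁ k hk hrow F q
  by_cases hnear : (geo9K i).dist q.1 y' ≤ (ℓ : ℝ) + 4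
  · have hsum : ∑ f : FBondY i, k q.1 f * ∑ a, |F (f, q.2.1, a, q.2.2.2)| ≤ K * ((Fintype.card κ : ℝ) * Bμ) := by
      calc ∑ f : FBondY i, k q.1 f * ∑ a, |F (f, q.2.1, a, q.2.2.2)|
          ≤ ∑ f : FBondY i, k q.1 f * ((Fintype.card κ : ℝ) * Bμ) :=
            Finset.sum_le_sum fun f _ => mul_le_mul_of_nonneg_left (hslice f) (hk _ _)
        _ = (∑ f : FBondY i, k q.1 f) * ((Fintype.card κ : ℝ) * Bμ) := by rw [Finset.sum_mul]
        _ ≤ K * ((Fintype.card κ : ℝ) * Bμ) := mul_le_mul_of_nonneg_right (hmass q.1) (mul_nonneg (Nat.cast_nonneg _) hμ.nonneg)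
    have hbb : 0 ≤ basisBound39 b := Finset.sum_nonneg fun _ _ => norm_nonneg _
    have h1 : |QcoKHq i b B cfg 𝔮 U₁ F q| ≤ K * Bμ := by
      refine hpt.trans ?_
      calc (cR39 b)⁻¹ * (coordBound39 b * (basisBound39 b * ∑ f : FBondY i, k q.1 f * ∑ a, |F (f, q.2.1, a, q.2.2.2)|))
          ≤ (cR39 b)⁻¹ * (coordBound39 b * (basisBound39 b * (K * ((Fintype.card κ : ℝ) * Bμ)))) :=
            mul_le_mul_of_nonneg_left (mul_le_mul_of_nonneg_left (mul_le_mul_of_nonneg_left hsum hbb) (norm_nonneg _)) (inv_nonneg.mpr (cR39_nonneg b))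
        _ = K * ((cR39 b)⁻¹ * (coordBound39 b * (basisBound39 b * ((Fintype.card κ : ℝ) * Bμ)))) := by ring
        _ ≤ K * Bμ := mul_le_mul_of_nonneg_left (reading_const_collapse b hμ.nonneg) hK
    have hK1 : 1 ≤ Real.exp (δ * ((ℓ : ℝ) + 4)) * Real.exp (-(δ * (geo9K i).dist (blkHK i q) y')) := by
      rw [← Real.exp_add]
      refine Real.one_le_exp ?_
      change 0 ≤ δ * ((ℓ : ℝ) + 4) + -(δ * (geo9K i).dist q.1 y')
      nlinarith [mul_le_mul_of_nonneg_left hnear hδ]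
    show |QcoKHq i b B cfg 𝔮 U₁ F q| ≤ K * Real.exp (δ * ((ℓ : ℝ) + 4)) * Real.exp (-(δ * (geo9K i).dist (blkHK i q) y')) * Bμ
    calc |QcoKHq i b B cfg 𝔮 U₁ F q| ≤ K * Bμ := h1
      _ = K * 1 * Bμ := by rw [mul_one]
      _ ≤ K * (Real.exp (δ * ((ℓ : ℝ) + 4)) * Real.exp (-(δ * (geo9K i).dist (blkHK i q) y'))) * Bμ :=
          mul_le_mul_of_nonneg_right (mul_le_mul_of_nonneg_left hK1 hK) hμ.nonneg
      _ = _ := by ring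
  · have hsum0 : ∑ f : FBondY i, k q.1 f * ∑ a, |F (f, q.2.1, a, q.2.2.2)| = 0 := by
      refine Finset.sum_eq_zero fun f _ => ?_
      by_cases hf : bI f = y'
      · by_cases hq : k q.1 f = 0
        · rw [hq, zero_mul]
        · exact absurd (hf ▸ hsupp q.1 f hq) hnear
      · rw [hslice0 f hf, mul_zero]
    rw [hsum0, mul_zero, mul_zero, mul_zero] at hpt
    exact hpt.trans (mul_nonneg hK0 hμ.nonneg)

/-- ★★ **THE LETTERS `Q(U₁) : 𝔠⁽ᵖ⁾ → 𝔠_Z⁽ᵖ⁾` FROM A ROW KERNEL** (w5's `hasMaj_QcoKH` verbatim with the constant `K`): majorant `K·Lᵖ·e^{2ε(ℓ+4)}·e^{−εd}` for every member above the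
[4] (2.60) threshold `p·log L ≤ ε(2L² − 1)M`. [cite: Balaban1985BackgroundPropagators, Thm 3.13 p.426 (the letter Q), (3.110) p.417, p.398 (remark after (3.47)); Balaban1984PropagatorsII, (2.51) p.232, (2.60) p.234] -/
theorem hasMaj_QcoKHq_of_rowKernel (hG : GeoOK (geo9K i)) [Fintype (geo9K i).Site] {U₁ : B.Cfg} (k : IBondY i → FBondY i → ℝ) (hk : ∀ ι f, 0 ≤ k ι f)
    (hsupp : ∀ ι f, k ι f ≠ 0 → (geo9K i).dist ι (bI f) ≤ (ℓ : ℝ) + 4) {K : ℝ} (hK : 0 ≤ K) (hmass : ∀ ι, ∑ f, k ι f ≤ K)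
    (hrow : ∀ (a : FBondY i → 𝔸) (ι : IBondY i), ‖𝔮 (cfg U₁) a ι‖ ≤ ∑ f, k ι f * ‖a f‖)
    {ε : ℝ} (hε : 0 < ε) (p : ℕ) (hM : (p : ℝ) * Real.log (geo9K i).L ≤ ε * (2 * ((ℓ : ℝ) + 1) ^ 2 - 1) * (geo9K i).M)
    {R₀ : ℝ} {H₀ : Prop} :
    HasMaj (cNorm R₀ H₀ (blkBK i bI) hG.lenle p) (cNorm R₀ H₀ (blkHK i) hG.lenle p) (QcoKHq i b B cfg 𝔮 U₁)
      (fun a a' => K * (geo9K i).L ^ p * Real.exp (2 * ε * ((ℓ : ℝ) + 4)) * Real.exp (-(ε * (geo9K i).dist a a'))) := by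
  have h2ε : (0 : ℝ) ≤ 2 * ε := by positivity
  have hKm := hasMajorantHom_QcoKHq_of_rowKernel i b B cfg 𝔮 k hk hsupp hK hmass hrow h2ε R₀ H₀
  have hK0 : ∀ a a' : (geo9K i).Site, 0 ≤ K * Real.exp (2 * ε * ((ℓ : ℝ) + 4)) * Real.exp (-(2 * ε * (geo9K i).dist a a')) :=
    fun a a' => by positivity
  have h0 := B9Thm37AllNorms.hasMaj_of_hasMajorantHom (G := toB6 (geo9K i) R₀ H₀) (blkBK i bI) (blkHK i) hK0 hKm
  refine (B9Thm312WholeLeaf.hasMaj_cNorm_of_hasMaj hG p p h0).mono fun y y' => ?_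
  have ht := len_pow_le_of_transfer i hε p hM y y'
  have hly : 0 < (geo9K i).len y ^ p := pow_pos (hG.lenpos y) p
  have hw : wt (geo9K i) p y * (geo9K i).len y' ^ p ≤ (geo9K i).L ^ p * Real.exp (ε * (geo9K i).dist y y') := by
    rw [wt, inv_mul_le_iff₀ hly]
    calc (geo9K i).len y' ^ p ≤ (geo9K i).L ^ p * Real.exp (ε * (geo9K i).dist y y') * (geo9K i).len y ^ p := ht
      _ = (geo9K i).len y ^ p * ((geo9K i).L ^ p * Real.exp (ε * (geo9K i).dist y y')) := by ring
  have hexp : Real.exp (-(2 * ε * (geo9K i).dist y y')) * Real.exp (ε * (geo9K i).dist y y') = Real.exp (-(ε * (geo9K i).dist y y')) := by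
    rw [← Real.exp_add]; congr 1; ring
  calc K * Real.exp (2 * ε * ((ℓ : ℝ) + 4)) * Real.exp (-(2 * ε * (geo9K i).dist y y')) * wt (geo9K i) p y * (geo9K i).len y' ^ p
      = K * Real.exp (2 * ε * ((ℓ : ℝ) + 4)) * Real.exp (-(2 * ε * (geo9K i).dist y y')) * (wt (geo9K i) p y * (geo9K i).len y' ^ p) := by ring
    _ ≤ K * Real.exp (2 * ε * ((ℓ : ℝ) + 4)) * Real.exp (-(2 * ε * (geo9K i).dist y y')) *
          ((geo9K i).L ^ p * Real.exp (ε * (geo9K i).dist y y')) := mul_le_mul_of_nonneg_left hw (hK0 y y')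
    _ = K * (geo9K i).L ^ p * Real.exp (2 * ε * ((ℓ : ℝ) + 4)) *
          (Real.exp (-(2 * ε * (geo9K i).dist y y')) * Real.exp (ε * (geo9K i).dist y y')) := by ring
    _ = _ := by rw [hexp]

end RowKernel

/-! ## §2 The knit letter's row kernel on the member's local class (3.35); the law `hqK` at the knit pair of record -/

section KnitRow

open scoped Matrix

variable {d ℓ : ℕ} {hd : 1 ≤ d + 1} {hL : Odd (ℓ + 1) ∧ 1 < ℓ + 1} {b₀ b₁ : ℝ} (i : KIdx d ℓ hd hL b₀ b₁) {bI : FBondY i → IBondY i}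

/-- a fine bond met by the double box of `ι` (`boxK ι f ≠ 0`) has its carrier block within `ℓ + 4` of `ι` in `geo9K` (the shape of n06-w3's `dist_le_of_qwt_ne_zero_bI`:
`f₋` lies in an end block of `ι` — `iterBlockOf_of_boxK_ne_zero` — so [6]'s `geomT_dist_ends_le` and the 1-faithfulness of `bI` apply).
[cite: Balaban1984PropagatorsII, (2.45)–(2.46) p.231; Balaban1985Averaging, p.24 (locality)] -/
theorem dist_le_of_boxK_ne_zero_bI (hβ1 : ∀ f : FBondY i, (geomT i.D).dist (β i.hN i.D i.hk (bI f)) (blkV1 i.hN i.D f) ≤ 1)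
    {ι : IBondY i} {f : FBondY i} (hf : boxK i ι f ≠ 0) : (geo9K i).dist ι (bI f) ≤ (ℓ : ℝ) + 4 := by
  change distB i (β i.hN i.D i.hk ι) (β i.hN i.D i.hk (bI f)) ≤ (ℓ : ℝ) + 4
  have h3 : distB i (β i.hN i.D i.hk ι) (blkV1 i.hN i.D f) ≤ (ℓ : ℝ) + 3 :=
    geomT_dist_ends_le i.hN i.D i.hk (one_le_k i) (two_le_RMh i) (one_le_Mh i) (one_le_P i) ι (iterBlockOf_of_boxK_ne_zero i hf)
  have h1 : distB i (β i.hN i.D i.hk (bI f)) (blkV1 i.hN i.D f) ≤ 1 := hβ1 f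
  have hs : distB i (blkV1 i.hN i.D f) (β i.hN i.D i.hk (bI f)) = distB i (β i.hN i.D i.hk (bI f)) (blkV1 i.hN i.D f) :=
    dist_symm_geoBT (toKT i) _ _
  linarith [distB_triangle i (β i.hN i.D i.hk ι) (blkV1 i.hN i.D f) (β i.hN i.D i.hk (bI f))]

/-- the knit row kernel is supported within `ℓ + 4` of `bI`. [cite: Balaban1984PropagatorsII, (2.45)–(2.46) p.231; Balaban1985Averaging, p.24 (locality)] -/
theorem dist_le_of_knitRow_ne_zero_bI (hβ1 : ∀ f : FBondY i, (geomT i.D).dist (β i.hN i.D i.hk (bI f)) (blkV1 i.hN i.D f) ≤ 1)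
    {α₀' : ℝ} {ι : IBondY i} {f : FBondY i} (hf : qwt i.hN i.D i.hk ι f + kCol (d + 1) (ℓ + 1) * α₀' * boxK i ι f ≠ 0) :
    (geo9K i).dist ι (bI f) ≤ (ℓ : ℝ) + 4 := by
  by_cases hq : qwt i.hN i.D i.hk ι f = 0
  · have hb : boxK i ι f ≠ 0 := by
      intro hb; apply hf; rw [hq, hb, mul_zero, add_zero]
    exact dist_le_of_boxK_ne_zero_bI i hβ1 hb
  · exact dist_le_of_qwt_ne_zero_bI i hβ1 hq

/-- the knit row kernel's row mass: `Σ_f (q_ι(f) + K_col α₀′ boxK ι f) ≤ 1 + K_col·α₀′·2(d+1)`. [cite: Balaban1984PropagatorsI, (1.18) p.20 (Σ_f q_ι(f) = 1); Balaban1985Averaging, (139) p.39] -/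
theorem sum_knitRow_le {α₀' : ℝ} (hα : 0 ≤ α₀') (ι : IBondY i) :
    ∑ f, (qwt i.hN i.D i.hk ι f + kCol (d + 1) (ℓ + 1) * α₀' * boxK i ι f) ≤ 1 + kCol (d + 1) (ℓ + 1) * α₀' * (2 * ((d : ℝ) + 1)) := by
  simp only [Finset.sum_add_distrib, ← Finset.mul_sum, sum_qwt_eq_one i ι]
  have h := mul_le_mul_of_nonneg_left (sum_boxK_le i ι) (mul_nonneg (kCol_nonneg (d + 1) (ℓ + 1)) hα)
  linarith

variable {N : ℕ} [Nonempty (Fin N)]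

/-- ★★ **THE ROW BOUND OF THE KNIT LETTER ON (3.35)**: `‖(Q(U)a)(ι)‖ ≤ Σ_f (q_ι(f) + K_col α₀′ boxK ι f)·‖a f‖` for every member background `U` of the local class `(bg9KP …).Reg335 c₀ α₀` (`G ≤ U(N)`,
`c₀ ≤ 10`, `0 ≤ Mα₀`, x-free numerics `0 < α₀′ ≤ α_Q`, `K_pl(Mα₀)·L⁴ < α₀′`) — the corner row form `norm_QknitY_sub_boxAvg_le` plus the flat average's row bound (unitary
corner-tree transports `boxT ∈ G`). [cite: Balaban1985BackgroundPropagators, (3.12)–(3.15) p.393, (3.115) p.418, (3.35) p.396; Balaban1985Averaging, (139)–(147) pp.39–40, Prop. 2 p.26] -/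
theorem norm_QknitY_apply_le_sum_knitRow {G : Subgroup (Matrix (Fin N) (Fin N) ℂ)ˣ} (hGU : G ≤ unitaryUnits (Matrix (Fin N) (Fin N) ℂ))
    {U : CfgY (Matrix (Fin N) (Fin N) ℂ) i} {c₀ α₀ : ℝ} (hc : c₀ ≤ 10) (hMα : 0 ≤ (kGeo i).M * α₀)
    (hreg : (bg9KP (Matrix (Fin N) (Fin N) ℂ) G i).Reg335 c₀ α₀ U) {α₀' : ℝ} (hα' : 0 < α₀') (hαQ : α₀' ≤ alphaQ (d + 1) (ℓ + 1))
    (hK : Kpl i ((kGeo i).M * α₀) * (kGeo i).L ^ 4 < α₀') (a : FBondY i → Matrix (Fin N) (Fin N) ℂ) (ι : IBondY i) :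
    ‖QknitY i U a ι‖ ≤ ∑ f, (qwt i.hN i.D i.hk ι f + kCol (d + 1) (ℓ + 1) * α₀' * boxK i ι f) * ‖a f‖ := by
  letI : CStarAlgebra (Matrix (Fin N) (Fin N) ℂ) := {}
  have hG1 : ∀ u : (Matrix (Fin N) (Fin N) ℂ)ˣ, u ∈ G → ‖(u : Matrix (Fin N) (Fin N) ℂ)‖ ≤ 1 :=
    fun u hu => (B7Prop1Explicit.mem_U1.1 (unitaryUnits_le_U1 (hGU hu))).1
  have hU : ∀ μ x, U μ x ∈ G := mem_of_reg335P (G := G) i hreg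
  have hrow := norm_QknitY_sub_boxAvg_le i hG1 hGU hc hMα hreg hα' hαQ hK a ι
  have havg : ‖∑ f, ((qK i ι f : ℝ) : ℂ) • conjR (boxT i U ι f) (a f)‖ ≤ ∑ f, qwt i.hN i.D i.hk ι f * ‖a f‖ := by
    refine (norm_sum_le _ _).trans (Finset.sum_le_sum fun f _ => ?_)
    rw [norm_smul, Complex.norm_real, Real.norm_eq_abs, qK_apply, abs_of_nonneg (qwt_nonneg _ _ _ _ _)]
    exact mul_le_mul_of_nonneg_left (norm_conjR_le_of_unitary (hGU (boxT_mem i hU ι f)) _) (qwt_nonneg _ _ _ _ _)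
  have hsplit : ∑ f, (qwt i.hN i.D i.hk ι f + kCol (d + 1) (ℓ + 1) * α₀' * boxK i ι f) * ‖a f‖ =
      ∑ f, qwt i.hN i.D i.hk ι f * ‖a f‖ + kCol (d + 1) (ℓ + 1) * α₀' * ∑ f, boxK i ι f * ‖a f‖ := by
    simp only [add_mul, Finset.sum_add_distrib, Finset.mul_sum, mul_assoc]
  rw [hsplit]
  calc ‖QknitY i U a ι‖ = ‖∑ f, ((qK i ι f : ℝ) : ℂ) • conjR (boxT i U ι f) (a f) + (QknitY i U a ι - ∑ f, ((qK i ι f : ℝ) : ℂ) • conjR (boxT i U ι f) (a f))‖ := by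
        rw [add_sub_cancel]
    _ ≤ _ := (norm_add_le _ _).trans (add_le_add havg hrow)

/-- ★★★ **THE CLASS LETTERS OF `Q(U)` AT THE KNIT LETTER ON (3.35)**: `Q(U) : 𝔠⁽ᵖ⁾ → 𝔠_Z⁽ᵖ⁾` with majorant `(1 + 2(d+1)K_col α₀′)·Lᵖ·e^{2ε(ℓ+4)}·e^{−εd}` at def-Y's coordinate model
`QcoKHq … (QknitY i) U₁` (any carrier `B` with `cfg U₁` in the member's local class), for every member above the (2.60) threshold `p·log L ≤ ε(2L²−1)M`.
[cite: Balaban1985BackgroundPropagators, Thm 3.13 p.426 (the letter Q), (3.12)–(3.15) p.393, (3.115) p.418, (3.35) p.396; Balaban1985Averaging, Prop. 2 p.26; Balaban1984PropagatorsII, (2.51) p.232, (2.60) p.234] -/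
theorem hasMaj_QcoKHq_QknitY_of_reg335P (hG : GeoOK (geo9K i)) [Fintype (geo9K i).Site]
    (hβ1 : ∀ f : FBondY i, (geomT i.D).dist (β i.hN i.D i.hk (bI f)) (blkV1 i.hN i.D f) ≤ 1)
    {G : Subgroup (Matrix (Fin N) (Fin N) ℂ)ˣ} (hGU : G ≤ unitaryUnits (Matrix (Fin N) (Fin N) ℂ))
    (B : B9.Backgrounds) (cfg : B.Cfg → CfgY (Matrix (Fin N) (Fin N) ℂ) i) {U₁ : B.Cfg} {c₀ α₀ : ℝ} (hc : c₀ ≤ 10) (hMα : 0 ≤ (kGeo i).M * α₀)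
    (hreg : (bg9KP (Matrix (Fin N) (Fin N) ℂ) G i).Reg335 c₀ α₀ (cfg U₁)) {α₀' : ℝ} (hα' : 0 < α₀') (hαQ : α₀' ≤ alphaQ (d + 1) (ℓ + 1))
    (hK : Kpl i ((kGeo i).M * α₀) * (kGeo i).L ^ 4 < α₀')
    {ε : ℝ} (hε : 0 < ε) (p : ℕ) (hM : (p : ℝ) * Real.log (geo9K i).L ≤ ε * (2 * ((ℓ : ℝ) + 1) ^ 2 - 1) * (geo9K i).M) {R₀ : ℝ} {H₀ : Prop} :
    HasMaj (cNorm R₀ H₀ (blkBK i bI) hG.lenle p) (cNorm R₀ H₀ (blkHK i) hG.lenle p) (QcoKHq i (trBasis N) B cfg (QknitY i) U₁)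
      (fun a a' => (1 + kCol (d + 1) (ℓ + 1) * α₀' * (2 * ((d : ℝ) + 1))) * (geo9K i).L ^ p * Real.exp (2 * ε * ((ℓ : ℝ) + 4)) *
        Real.exp (-(ε * (geo9K i).dist a a'))) :=
  hasMaj_QcoKHq_of_rowKernel i (trBasis N) B cfg (QknitY i) hG (fun ι f => qwt i.hN i.D i.hk ι f + kCol (d + 1) (ℓ + 1) * α₀' * boxK i ι f)
    (fun ι f => add_nonneg (qwt_nonneg _ _ _ _ _) (mul_nonneg (mul_nonneg (kCol_nonneg _ _) hα'.le) (boxK_nonneg i ι f)))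
    (fun _ _ h => dist_le_of_knitRow_ne_zero_bI i hβ1 h) (by have := kCol_nonneg (d + 1) (ℓ + 1); positivity) (sum_knitRow_le i hα'.le)
    (norm_QknitY_apply_le_sum_knitRow i hGU hc hMα hreg hα' hαQ hK) hε p hM

end KnitRow

/-! ## §3 The assembler's binder `hqK` at the knit pair of record -/

section KnitBinder

open scoped Matrix

variable {N : ℕ} [Nonempty (Fin N)] (θ : Stage3Params) (Mstar : ℕ) {R₁ R₂ : RegFamY θ.d₆ θ.ℓ₆ θ.hd' θ.hL' θ.b₀ θ.b₁ Mstar (Matrix (Fin N) (Fin N) ℂ)} {c : ℝ}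
variable [∀ x : MemberY θ.d₆ θ.ℓ₆ θ.hd' θ.hL' θ.b₀ θ.b₁ Mstar, Fintype (geo9Y x).Site]

/-- ★★★ **THE CERTIFICATE's BINDER `hqK` AT THE KNIT PAIR, FROM THE DISPLAYED REGIME BRIDGE AND X-FREE NUMERICS**: at any Sect.-D record `𝔬12` whose `Q` is pinned to def-Y's
`QcoKHq … (qKnitOfRecord …)` (`hQco12`, `pins312K_of_eq`'s conjunct) and block maps `blkBK (bI x) ∕ blkHK` (`hblk12 ∕ hblkZ12`), over the class-parametric carrier: the
regime bridge `hRP` (the certificate's `hRP1` — the carrier's class at `c` refines the member's local class `(bg9KP … SU(N) …).Reg335 c₀` with `c₀ ≤ 10`), the x-free knit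
numerics `0 < α₀′ ≤ α_Q`, `hKpl : 0 ≤ a ≤ a12 ⇒ K_pl(a)·L⁴ < α₀′` (dag-n06-d's `hKplK` shape) and the (2.60) numeric `hM12q : 2·log L ≤ δ12₃(2L²−1)·M12` of v1.7 (with
`0 < M12`) give `t312_t313_of_pins_stateSUCLE_par`'s `hqK` VERBATIM with `BQp := (1 + 2(d+1)K_col α₀′)·L²·e^{2δ12₃(ℓ+4)}`.
[cite: Balaban1985BackgroundPropagators, Thm 3.13 p.426 (the letter Q), (3.115) p.418, (3.35) p.396; Balaban1985Averaging, Prop. 2 p.26; Balaban1984PropagatorsII, (2.51) p.232, (2.60) p.234] -/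
theorem hqK_knit_of_laws
    {W12 : MemberY θ.d₆ θ.ℓ₆ θ.hd' θ.hL' θ.b₀ θ.b₁ Mstar → Type} [∀ x, Fintype (W12 x)]
    (𝔬12 : ∀ x : MemberY θ.d₆ θ.ℓ₆ θ.hd' θ.hL' θ.b₀ θ.b₁ Mstar, Ops (geo9Y x) (bg9YR (Matrix (Fin N) (Fin N) ℂ) (specialUnitaryUnits (Fin N)) R₁ R₂ x) (XBK (TrIdx N) x.toKIdx) (XBK (TrIdx N) x.toKIdx) (XHK (TrIdx N) x.toKIdx) (W12 x))
    (bI : ∀ x : MemberY θ.d₆ θ.ℓ₆ θ.hd' θ.hL' θ.b₀ θ.b₁ Mstar, FBondY x.toKIdx → IBondY x.toKIdx)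
    (hβ1 : ∀ (x : MemberY θ.d₆ θ.ℓ₆ θ.hd' θ.hL' θ.b₀ θ.b₁ Mstar) (f : FBondY x.toKIdx), (geomT x.D).dist (β x.hN x.D x.hk (bI x f)) (blkV1 x.hN x.D f) ≤ 1)
    (H12 : MemberY θ.d₆ θ.ℓ₆ θ.hd' θ.hL' θ.b₀ θ.b₁ Mstar → Prop)
    (hblk12 : ∀ x : MemberY θ.d₆ θ.ℓ₆ θ.hd' θ.hL' θ.b₀ θ.b₁ Mstar, (𝔬12 x).blk = blkBK x.toKIdx (bI x)) (hblkZ12 : ∀ x : MemberY θ.d₆ θ.ℓ₆ θ.hd' θ.hL' θ.b₀ θ.b₁ Mstar, (𝔬12 x).blkZ = blkHK x.toKIdx)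
    (hQco12 : ∀ (x : MemberY θ.d₆ θ.ℓ₆ θ.hd' θ.hL' θ.b₀ θ.b₁ Mstar) (U : (bg9YR (Matrix (Fin N) (Fin N) ℂ) (specialUnitaryUnits (Fin N)) R₁ R₂ x).Cfg),
      (𝔬12 x).Q U = QcoKHq x.toKIdx (trBasis N) (bg9YR (Matrix (Fin N) (Fin N) ℂ) (specialUnitaryUnits (Fin N)) R₁ R₂ x) (fun U => U) (qKnitOfRecord N θ x.toKIdx) U)
    {M12 a12 δ12₃ : ℝ} (hM12 : 0 < M12) (hδ30 : 0 < δ12₃)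
    (hM12q : (2 : ℝ) * Real.log (((θ.ℓ₆ + 1 : ℕ) : ℝ)) ≤ δ12₃ * (2 * ((θ.ℓ₆ : ℝ) + 1) ^ 2 - 1) * M12)
    -- the regime bridge (the certificate's `hRP1`) and the x-free knit numerics (dag-n06-d's `hKplK` shape)
    {c₀ : ℝ} (hc : c₀ ≤ 10)
    (hRP : ∀ (x : MemberY θ.d₆ θ.ℓ₆ θ.hd' θ.hL' θ.b₀ θ.b₁ Mstar) (α₀ : ℝ) (U : (bg9YR (Matrix (Fin N) (Fin N) ℂ) (specialUnitaryUnits (Fin N)) R₁ R₂ x).Cfg),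
      (bg9YR (Matrix (Fin N) (Fin N) ℂ) (specialUnitaryUnits (Fin N)) R₁ R₂ x).Reg335 c α₀ U → (bg9KP (Matrix (Fin N) (Fin N) ℂ) (specialUnitaryUnits (Fin N)) x.toKIdx).Reg335 c₀ α₀ U)
    {α₀' : ℝ} (hα' : 0 < α₀') (hαQ : α₀' ≤ alphaQ (θ.d₆ + 1) (θ.ℓ₆ + 1))
    (hKpl : ∀ (x : MemberY θ.d₆ θ.ℓ₆ θ.hd' θ.hL' θ.b₀ θ.b₁ Mstar) (a : ℝ), 0 ≤ a → a ≤ a12 → Kpl x.toKIdx a * (kGeo x.toKIdx).L ^ 4 < α₀') :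
    ∀ x : MemberY θ.d₆ θ.ℓ₆ θ.hd' θ.hL' θ.b₀ θ.b₁ Mstar, M12 ≤ (geo9Y x).M → ∀ α₀ : ℝ, 0 < α₀ → (geo9Y x).M * α₀ ≤ a12 →
      ∀ U : (bg9YR (Matrix (Fin N) (Fin N) ℂ) (specialUnitaryUnits (Fin N)) R₁ R₂ x).Cfg, (bg9YR (Matrix (Fin N) (Fin N) ℂ) (specialUnitaryUnits (Fin N)) R₁ R₂ x).Reg335 c α₀ U →
        ∀ p : ℕ, p ≤ 2 → HasMaj (cNorm 1 (H12 x) (𝔬12 x).blk (fun y => (geo9Y_len_pos x y).le) p) (cNorm 1 (H12 x) (𝔬12 x).blkZ (fun y => (geo9Y_len_pos x y).le) p) ((𝔬12 x).Q U)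
          (fun a b => ((1 + kCol (θ.d₆ + 1) (θ.ℓ₆ + 1) * α₀' * (2 * ((θ.d₆ : ℝ) + 1))) * (((θ.ℓ₆ + 1 : ℕ) : ℝ)) ^ 2 * Real.exp (2 * δ12₃ * ((θ.ℓ₆ : ℝ) + 4))) *
            Real.exp (-(δ12₃ * (geo9Y x).dist a b))) := by
  intro x hM α₀ hα ha U hU p hp
  letI : Fintype (geo9K x.toKIdx).Site := (inferInstance : Fintype (geo9Y x).Site)
  have hgeo : GeoOK (geo9Y x) := ⟨geo9Y_dist_triangle x, geo9Y_dist_comm x, geo9K_dist_nonneg x.toKIdx, geo9Y_len_pos x⟩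
  have hL1 : (1 : ℝ) ≤ ((θ.ℓ₆ + 1 : ℕ) : ℝ) := by exact_mod_cast Nat.succ_le_succ (Nat.zero_le _)
  have hMx : 0 ≤ (geo9Y x).M := hM12.le.trans hM
  have hMα : 0 ≤ (kGeo x.toKIdx).M * α₀ := mul_nonneg hMx hα.le
  have hKx : Kpl x.toKIdx ((kGeo x.toKIdx).M * α₀) * (kGeo x.toKIdx).L ^ 4 < α₀' := hKpl x _ hMα ha
  have hthr : (p : ℝ) * Real.log (geo9K x.toKIdx).L ≤ δ12₃ * (2 * ((θ.ℓ₆ : ℝ) + 1) ^ 2 - 1) * (geo9K x.toKIdx).M :=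
    calc (p : ℝ) * Real.log (geo9K x.toKIdx).L ≤ 2 * Real.log (((θ.ℓ₆ + 1 : ℕ) : ℝ)) := mul_le_mul_of_nonneg_right (by exact_mod_cast hp) (Real.log_nonneg hL1)
      _ ≤ δ12₃ * (2 * ((θ.ℓ₆ : ℝ) + 1) ^ 2 - 1) * M12 := hM12q
      _ ≤ δ12₃ * (2 * ((θ.ℓ₆ : ℝ) + 1) ^ 2 - 1) * (geo9Y x).M :=
          mul_le_mul_of_nonneg_left hM (mul_nonneg hδ30.le (by nlinarith [sq_nonneg (θ.ℓ₆ : ℝ), Nat.cast_nonneg (α := ℝ) θ.ℓ₆]))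
  have h := hasMaj_QcoKHq_QknitY_of_reg335P x.toKIdx hgeo (hβ1 x) specialUnitaryUnits_le_unitaryUnits
    (bg9YR (Matrix (Fin N) (Fin N) ℂ) (specialUnitaryUnits (Fin N)) R₁ R₂ x) (fun U => U) hc hMα (hRP x α₀ U hU) hα' hαQ hKx hδ30 p hthr (R₀ := (1 : ℝ)) (H₀ := H12 x)
  rw [hblk12 x, hblkZ12 x, hQco12 x U]
  have hLp : (geo9K x.toKIdx).L ^ p ≤ (((θ.ℓ₆ + 1 : ℕ) : ℝ)) ^ 2 := pow_le_pow_right₀ hL1 hp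
  have hK0 : 0 ≤ 1 + kCol (θ.d₆ + 1) (θ.ℓ₆ + 1) * α₀' * (2 * ((θ.d₆ : ℝ) + 1)) := by have := kCol_nonneg (θ.d₆ + 1) (θ.ℓ₆ + 1); positivity
  refine h.mono fun a b' => mul_le_mul_of_nonneg_right ?_ (Real.exp_nonneg _)
  exact mul_le_mul_of_nonneg_right (mul_le_mul_of_nonneg_left hLp hK0) (Real.exp_nonneg _)

end KnitBinder


/-! ## §4 (v1.1, APPEND-ONLY) The (3.15) block-`Hom` law `hQ15` of P-D2-knit at the knit pair of record -/

section KnitHomLaw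

open scoped Matrix
open Literature.MathematicalPhysics.QuantumFieldTheory.Balaban1983to89.B6RandomWalkHom (HasMajorantHom hasMajorantHom_mono)

variable {N : ℕ} [Nonempty (Fin N)] (θ : Stage3Params) (Mstar : ℕ) {R₁ R₂ : RegFamY θ.d₆ θ.ℓ₆ θ.hd' θ.hL' θ.b₀ θ.b₁ Mstar (Matrix (Fin N) (Fin N) ℂ)} {c : ℝ}
variable [∀ x : MemberY θ.d₆ θ.ℓ₆ θ.hd' θ.hL' θ.b₀ θ.b₁ Mstar, Fintype (geo9Y x).Site]

/-- ★★★ **THE (3.15) BLOCK LAW `hQ15` OF `…N06D2SupPrechainV2AtPinsPUWQ.d2sup_prechain_v2_of_pins_knit` AT THE KNIT PAIR OF RECORD, FROM THE REGIME BRIDGE AND X-FREE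
NUMERICS** (v1.1): for a pair `𝔮` pinned to `QknitY` (`h𝔮`), below `M·α₀ ≤ aK` on the carrier's (3.35) (bridge `hRP` to the member's local class `(bg9KP … SU(N) …).Reg335 c₀`, `c₀ ≤ 10`;
numerics `0 < α₀′ ≤ α_Q`, `hKpl`), at EVERY rate `δ ≥ 0`: `HasMajorantHom blkBK blkHK (QcoKHq … (𝔮 x) U) (B_Q·e^{δ(ℓ+4)}·e^{−δd})`, `B_Q = 1 + 2(d+1)·K(d+1,L)·α₀′` —
`hasMajorantHom_QcoKHq_of_rowKernel` fed the knit row kernel (`norm_QknitY_apply_le_sum_knitRow`, `sum_knitRow_le`, `dist_le_of_knitRow_ne_zero_bI`).  (Any positive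
threshold `MQ` serves; the law needs no (2.60) numeric.) [cite: Balaban1985BackgroundPropagators, (3.14)–(3.15) p.393, (3.115) p.418, (3.35) p.396; Balaban1985Averaging, (139)–(147) pp.39–40, Prop. 2 p.26; Balaban1984PropagatorsII, (2.51) p.232] -/
theorem hQ15_knit_of_laws
    (bI : ∀ x : MemberY θ.d₆ θ.ℓ₆ θ.hd' θ.hL' θ.b₀ θ.b₁ Mstar, FBondY x.toKIdx → IBondY x.toKIdx)
    (hβ1 : ∀ (x : MemberY θ.d₆ θ.ℓ₆ θ.hd' θ.hL' θ.b₀ θ.b₁ Mstar) (f : FBondY x.toKIdx), (geomT x.D).dist (β x.hN x.D x.hk (bI x f)) (blkV1 x.hN x.D f) ≤ 1)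
    (H12 : MemberY θ.d₆ θ.ℓ₆ θ.hd' θ.hL' θ.b₀ θ.b₁ Mstar → Prop)
    (𝔮 : ∀ x : MemberY θ.d₆ θ.ℓ₆ θ.hd' θ.hL' θ.b₀ θ.b₁ Mstar, QLetterY (Matrix (Fin N) (Fin N) ℂ) x.toKIdx)
    (h𝔮 : ∀ (x : MemberY θ.d₆ θ.ℓ₆ θ.hd' θ.hL' θ.b₀ θ.b₁ Mstar) (U : CfgY (Matrix (Fin N) (Fin N) ℂ) x.toKIdx), 𝔮 x U = QknitY x.toKIdx U)
    {MQ : ℝ} (hMQ : 0 < MQ) {c₀ : ℝ} (hc : c₀ ≤ 10)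
    (hRP : ∀ (x : MemberY θ.d₆ θ.ℓ₆ θ.hd' θ.hL' θ.b₀ θ.b₁ Mstar) (α₀ : ℝ) (U : (bg9YR (Matrix (Fin N) (Fin N) ℂ) (specialUnitaryUnits (Fin N)) R₁ R₂ x).Cfg),
      (bg9YR (Matrix (Fin N) (Fin N) ℂ) (specialUnitaryUnits (Fin N)) R₁ R₂ x).Reg335 c α₀ U → (bg9KP (Matrix (Fin N) (Fin N) ℂ) (specialUnitaryUnits (Fin N)) x.toKIdx).Reg335 c₀ α₀ U)
    {α₀' : ℝ} (hα' : 0 < α₀') (hαQ : α₀' ≤ alphaQ (θ.d₆ + 1) (θ.ℓ₆ + 1)) {aK : ℝ}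
    (hKpl : ∀ (x : MemberY θ.d₆ θ.ℓ₆ θ.hd' θ.hL' θ.b₀ θ.b₁ Mstar) (a : ℝ), 0 ≤ a → a ≤ aK → Kpl x.toKIdx a * (kGeo x.toKIdx).L ^ 4 < α₀') :
    ∀ x : MemberY θ.d₆ θ.ℓ₆ θ.hd' θ.hL' θ.b₀ θ.b₁ Mstar, MQ ≤ (geo9Y x).M → ∀ α₀ : ℝ, 0 < α₀ → (geo9Y x).M * α₀ ≤ aK →
      ∀ U : (bg9YR (Matrix (Fin N) (Fin N) ℂ) (specialUnitaryUnits (Fin N)) R₁ R₂ x).Cfg, (bg9YR (Matrix (Fin N) (Fin N) ℂ) (specialUnitaryUnits (Fin N)) R₁ R₂ x).Reg335 c α₀ U →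
      (bg9YR (Matrix (Fin N) (Fin N) ℂ) (specialUnitaryUnits (Fin N)) R₁ R₂ x).Reg336 c α₀ U →
        ∀ δ : ℝ, 0 ≤ δ → HasMajorantHom (g := toB6 (geo9Y x) 1 (H12 x)) (blkBK x.toKIdx (bI x)) (blkHK x.toKIdx)
          (QcoKHq x.toKIdx (trBasis N) (bg9YR (Matrix (Fin N) (Fin N) ℂ) (specialUnitaryUnits (Fin N)) R₁ R₂ x) (fun U => U) (𝔮 x) U)
          (fun a a' => (1 + kCol (θ.d₆ + 1) (θ.ℓ₆ + 1) * α₀' * (2 * ((θ.d₆ : ℝ) + 1))) * Real.exp (δ * ((θ.ℓ₆ : ℝ) + 4)) * Real.exp (-(δ * (geo9Y x).dist a a'))) := by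
  intro x hM α₀ hα ha U hU _ δ hδ
  letI : Fintype (geo9K x.toKIdx).Site := (inferInstance : Fintype (geo9Y x).Site)
  have hMx : 0 ≤ (geo9Y x).M := hMQ.le.trans hM
  have hMα : 0 ≤ (kGeo x.toKIdx).M * α₀ := mul_nonneg hMx hα.le
  have hKx : Kpl x.toKIdx ((kGeo x.toKIdx).M * α₀) * (kGeo x.toKIdx).L ^ 4 < α₀' := hKpl x _ hMα ha
  have h𝔮x : 𝔮 x = QknitY x.toKIdx := funext fun U => h𝔮 x U
  rw [h𝔮x]
  exact hasMajorantHom_QcoKHq_of_rowKernel x.toKIdx (trBasis N) (bg9YR (Matrix (Fin N) (Fin N) ℂ) (specialUnitaryUnits (Fin N)) R₁ R₂ x) (fun U => U) (QknitY x.toKIdx)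
    (fun ι f => qwt x.hN x.D x.hk ι f + kCol (θ.d₆ + 1) (θ.ℓ₆ + 1) * α₀' * boxK x.toKIdx ι f)
    (fun ι f => add_nonneg (qwt_nonneg _ _ _ _ _) (mul_nonneg (mul_nonneg (kCol_nonneg _ _) hα'.le) (boxK_nonneg x.toKIdx ι f)))
    (fun _ _ h => dist_le_of_knitRow_ne_zero_bI x.toKIdx (hβ1 x) h) (by have := kCol_nonneg (θ.d₆ + 1) (θ.ℓ₆ + 1); positivity)
    (sum_knitRow_le x.toKIdx hα'.le) (norm_QknitY_apply_le_sum_knitRow x.toKIdx specialUnitaryUnits_le_unitaryUnits hc hMα (hRP x α₀ U hU) hα' hαQ hKx) hδ 1 (H12 x)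

end KnitHomLaw

end Summit.QuantumFields.YangMills.BalabanUVNodes.N06Thm312313ParLawsQRow

end
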